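import Mathlib
import HarnessLib
import Literature.MathematicalPhysics.QuantumLattice.GrassmannCovarianceResponseFourLeg
import Literature.MathematicalPhysics.QuantumLattice.GrassmannKernelAntisymmetry
import Summits.HubbardSuperconductivity.HubbardSuperconductivity.Theorems.KLProgrammeKLRegimeEngineCovarianceResponseAtPoint

/-!
# K3 ENGINE child (stmt-HubbardSuperconductivity-20437 `KLRegimeEngineV17F2`), stub (c) `hshift` producer «(c)-HSHIFT-4LEG»:
# the COVARIANCE RESPONSE of the FOUR-leg kernel at one string, between two normal covariances, by Polchinski interpolation
# — loop term = entry sum of `Ċ` × a six-leg sup, tree term = PRODUCT (pointwise `ṡ`, no mass of `Ċ`)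

Cell gate-hubbard-kl, seat p2 (g23); the four-leg twin of p2 g10's `covResp_norm_kernel_two_sub_le`
(`…EngineCovarianceResponseAtPoint`), asked for by k3c2-p2 (g21, «(c)-HSHIFT-4LEG»): the frame-shift (`hshift`) estimate of the
quartic part of `𝒲[s] := effAction (normalCovariance s) V_U` read AT ONE STRING `X = (X₀,…,X₃)`.  Along the straight path
`s_t = s₀ + t(s₁ − s₀)` (`Ċ = normalCovariance (s₁ − s₀)`), Salmhofer's RGE read at `X` gives
(`Literature/…/GrassmannCovarianceResponseFourLeg`: the degree-`4` product formula and the `15`-position loop term):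

* §1 **selection rule in pairing form**: `𝒲₂(A, X) = 0` unless `A = X̄ := (X.1, 1 − X.2)` (`covResp_kernel_two_eq_zero_of_ne_bar`,
  from the charge / frequency–momentum–spin rules of `…EngineCovarianceResponseAtPoint` §2); the paired entries of a normal covariance
  have norm `‖ṡ(A.1)‖`; antisymmetry: the four strings `(X_i, X̂_i)` carry the norm of the kernel at `X` (`norm_kernel_four_minors_eq`);
* §2 **the loop term**: `‖kernel (Δ_Ċ 𝒲) 4 X‖ ≤ 30·(Σ_p ‖ṡ p‖)·N₆` for `N₆ ≥ ‖𝒲₆(X, Ā, A)‖` (`covResp_norm_kernel_four_laplacian_le`);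
* §3 **the tree term is a product**: `‖kernel (δ𝒲/δψ, Ċ δ𝒲/δψ) 4 X‖ ≤ 4·(Σ_i ‖ṡ(X_i.1)‖·‖𝒲₂(X̄_i, X_i)‖)·‖𝒲₄(X)‖`
  (`covResp_norm_kernel_four_pairing_le`: in `Σ_{A} Ċ(A,Ā)·[(∂_A𝒲)(∂_Ā𝒲)]₄(X)` only `A ∈ {X̄_i, X_i}` survive the selection rule);
* §4 **the response inequality** (`covResp_norm_kernel_four_sub_le`): with `Z_t ≠ 0`, `‖𝒲_{t,6}(X,Ā,A)‖ ≤ N₆`, `‖𝒲_{t,2}(X̄_i,X_i)‖ ≤ S`,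
  `‖𝒲_{t,4}(X)‖ ≤ N₄` on `[0,1]` and `‖(s₁−s₀)(X_i.1)‖ ≤ D`,
  `‖𝒲[s₁]₄(X) − 𝒲[s₀]₄(X)‖ ≤ 30·(Σ_p ‖(s₁−s₀) p‖)·N₆ + 8·D·S·N₄`.

For the engine's `hshift` (k3c2-p2): `s_i` = the resummed UV symbols of two frames, so `Σ_p‖s₁−s₀‖` is a shell sum and `D` a pointwise
shell bound, both `∝ frameDist` (`…EngineFrameShiftResponse`: `sum_norm_uvSymbolCT_sub_le`, `norm_uvSymbolCT_sub_le_unif`).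
Everything is proved; no definitions; nothing about the model's sizes is asserted (they enter as hypotheses `hZ`, `hN6`, `hS`, `hN4`, `hD`);
nothing here asserts (c), (C), K3 or superconductivity.  References: Salmhofer 1998 §3.1 Prop. 1, §4.1 [cite: Salmhofer1998];
Salmhofer 1999 §4.3 [cite: Salmhofer1999].
-/

noncomputable section

namespace Summit.HubbardSuperconductivity.HubbardSuperconductivity.Theorems.EngineV8

set_option linter.dupNamespace false -- summit = problem name (single-conjunct summit), D-0017

open Finset Literature.MathematicalPhysics.QuantumLattice Literature.Probability.LatticeModels GrassmannAlgebra
open Summit.HubbardSuperconductivity.HubbardSuperconductivity.Theorems.TwoPointAssembly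

variable {L M : ℕ} [NeZero L]

/-! ## §1 Selection rule in pairing form; paired entries; antisymmetry of the four-leg kernel -/

/-- **Selection rule, pairing form**: the two-leg kernel of `𝒲[s]` at `(A, X)` vanishes unless `A = X̄ := (X.1, 1 − X.2)`
(same `(frequency, momentum, spin)`, opposite charge). -/
theorem covResp_kernel_two_eq_zero_of_ne_bar (s : FreqMomentum L M × Fin 2 → ℂ) (β U : ℝ) {A X : HubbardFieldIdx L M}
    (h : A ≠ (X.1, 1 - X.2)) :
    kernel ℂ (effAction ℂ (normalCovariance L M s) (hubbardInteraction L M β U)) 2 ![A, X] = 0 := by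
  obtain ⟨p, c⟩ := A
  obtain ⟨q, d⟩ := X
  by_cases hcd : c = d
  · subst hcd
    exact covResp_kernel_two_eq_zero_of_charge_eq s β U p q c
  · have hpq : p ≠ q := by
      rintro rfl
      refine h (Prod.ext rfl ?_)
      show c = 1 - d
      fin_cases c <;> fin_cases d <;> simp_all
    fin_cases c <;> fin_cases d
    · exact absurd rfl hcd
    · exact (covResp_kernel_two_pair_eq_zero_of_ne s β U hpq).2
    · exact (covResp_kernel_two_pair_eq_zero_of_ne s β U hpq).1
    · exact absurd rfl hcd

omit [NeZero L] in
/-- The paired entries of a normal covariance in norm: `‖C(A, Ā)‖ = ‖s(A.1)‖`. -/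
theorem norm_normalCovariance_bar_right (s : FreqMomentum L M × Fin 2 → ℂ) (A : HubbardFieldIdx L M) :
    ‖normalCovariance L M s A (A.1, 1 - A.2)‖ = ‖s A.1‖ := by
  obtain ⟨p, c⟩ := A
  fin_cases c <;> simp [normalCovariance_apply]

omit [NeZero L] in
/-- The paired entries of a normal covariance in norm: `‖C(Ā, A)‖ = ‖s(A.1)‖`. -/
theorem norm_normalCovariance_bar_left (s : FreqMomentum L M × Fin 2 → ℂ) (A : HubbardFieldIdx L M) :
    ‖normalCovariance L M s (A.1, 1 - A.2) A‖ = ‖s A.1‖ := by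
  obtain ⟨p, c⟩ := A
  fin_cases c <;> simp [normalCovariance_apply]

/-- **Antisymmetry**: the four-leg kernel at each string `(X_i, X̂_i)` (`X̂_i` = `X` without its `i`-th leg, in order) has the norm of
the kernel at `X` (`norm_kernel_comp_perm`). -/
theorem norm_kernel_four_minors_eq (W : HubbardGrassmann L M) (X : Fin 4 → HubbardFieldIdx L M) :
    ‖kernel ℂ W 4 ![X 0, X 1, X 2, X 3]‖ = ‖kernel ℂ W 4 X‖ ∧ ‖kernel ℂ W 4 ![X 1, X 0, X 2, X 3]‖ = ‖kernel ℂ W 4 X‖ ∧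
      ‖kernel ℂ W 4 ![X 2, X 0, X 1, X 3]‖ = ‖kernel ℂ W 4 X‖ ∧ ‖kernel ℂ W 4 ![X 3, X 0, X 1, X 2]‖ = ‖kernel ℂ W 4 X‖ := by
  classical
  have h0 : ![X 0, X 1, X 2, X 3] = X := by
    funext j; fin_cases j <;> rfl
  have h1 : ![X 1, X 0, X 2, X 3] = X ∘ ⇑(Equiv.swap (0 : Fin 4) 1) := by
    funext j; fin_cases j <;> rfl
  have h2 : ![X 2, X 0, X 1, X 3] = X ∘ ⇑(Equiv.swap (0 : Fin 4) 1 * Equiv.swap (0 : Fin 4) 2) := by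
    funext j; fin_cases j <;> rfl
  have h3 : ![X 3, X 0, X 1, X 2] = X ∘ ⇑(Equiv.swap (0 : Fin 4) 1 * Equiv.swap (0 : Fin 4) 2 * Equiv.swap (0 : Fin 4) 3) := by
    funext j; fin_cases j <;> rfl
  refine ⟨by rw [h0], ?_, ?_, ?_⟩
  · rw [h1]; exact Literature.MathematicalPhysics.QuantumLattice.norm_kernel_comp_perm W 4 X _
  · rw [h2]; exact Literature.MathematicalPhysics.QuantumLattice.norm_kernel_comp_perm W 4 X _
  · rw [h3]; exact Literature.MathematicalPhysics.QuantumLattice.norm_kernel_comp_perm W 4 X _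

/-! ## §2 The loop term at one four-leg string -/

/-- **The loop term of the four-leg response**: `‖kernel (Δ_Ċ W) 4 X‖ ≤ 30·(Σ_p ‖ṡ p‖)·N` whenever `‖W₆(X, Ā, A)‖ ≤ N` for all `A`
(`Ċ = normalCovariance ṡ`: entry sum `2Σ|ṡ|`; `15` pair positions). -/
theorem covResp_norm_kernel_four_laplacian_le (sdot : FreqMomentum L M × Fin 2 → ℂ) (W : HubbardGrassmann L M)
    (X : Fin 4 → HubbardFieldIdx L M) {N : ℝ}
    (hN : ∀ A : HubbardFieldIdx L M, ‖kernel ℂ W 6 (Fin.snoc (Fin.snoc X (A.1, 1 - A.2) : Fin 5 → HubbardFieldIdx L M) A)‖ ≤ N) :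
    ‖kernel ℂ (grassmannLaplacian ℂ (normalCovariance L M sdot) W) 4 X‖ ≤ 30 * (∑ p, ‖sdot p‖) * N := by
  have h := norm_kernel_four_grassmannLaplacian_le_of_pairing (normalCovariance L M sdot) (fun A => (A.1, 1 - A.2))
    (fun A B hB => normalCovariance_eq_zero_of_ne_bar sdot A B hB) W X hN
  have hs : ∑ A : HubbardFieldIdx L M, ‖normalCovariance L M sdot A ((fun A : HubbardFieldIdx L M => (A.1, 1 - A.2)) A)‖ =
      2 * ∑ p, ‖sdot p‖ := sum_norm_normalCovariance_bar sdot
  rw [hs] at h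
  calc _ ≤ 15 * (2 * ∑ p, ‖sdot p‖) * N := h
    _ = 30 * (∑ p, ‖sdot p‖) * N := by ring

/-! ## §3 The tree term at one four-leg string is a product -/

/-- **The tree (pairing) term of the four-leg response at `X` in norm is a PRODUCT**:
`‖kernel (δ𝒲/δψ, Ċ δ𝒲/δψ) 4 X‖ ≤ 4·(Σ_i ‖ṡ(X_i.1)‖·‖𝒲₂(X̄_i, X_i)‖)·‖𝒲₄(X)‖` for `Ċ = normalCovariance ṡ`, `𝒲 = 𝒲[s]`:
in `Σ_A Ċ(A,Ā)·[(∂_A 𝒲)(∂_Ā 𝒲)]₄(X)` (degree-`4` product formula) the selection rule leaves only `A ∈ {X̄_i, X_i}`, and the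
surviving four-leg kernels sit at the strings `(X_i, X̂_i)`, of norm `‖𝒲₄(X)‖` by antisymmetry.  No mass of `Ċ`. -/
theorem covResp_norm_kernel_four_pairing_le (sdot s : FreqMomentum L M × Fin 2 → ℂ) (β U : ℝ) (X : Fin 4 → HubbardFieldIdx L M) :
    ‖kernel ℂ (grassmannDerivPairing ℂ (normalCovariance L M sdot)
        (effAction ℂ (normalCovariance L M s) (hubbardInteraction L M β U))
        (effAction ℂ (normalCovariance L M s) (hubbardInteraction L M β U))) 4 X‖ ≤
      4 * (∑ i : Fin 4, ‖sdot (X i).1‖ *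
          ‖kernel ℂ (effAction ℂ (normalCovariance L M s) (hubbardInteraction L M β U)) 2
            ![(((X i).1, 1 - (X i).2) : HubbardFieldIdx L M), X i]‖) *
        ‖kernel ℂ (effAction ℂ (normalCovariance L M s) (hubbardInteraction L M β U)) 4 X‖ := by
  classical
  set W := effAction ℂ (normalCovariance L M s) (hubbardInteraction L M β U) with hW
  have hWe : W ∈ evenOdd ℂ (ι := HubbardFieldIdx L M) 0 :=
    mem_evenPart_iff.1 (effAction_mem_evenPart _ (mem_evenPart_iff.2 (hubbardInteraction_mem_evenOdd_zero β U))
      (constPart_hubbardInteraction L M β U))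
  have hbb : ∀ A : HubbardFieldIdx L M,
      ((((A.1, 1 - A.2) : HubbardFieldIdx L M).1, 1 - ((A.1, 1 - A.2) : HubbardFieldIdx L M).2) : HubbardFieldIdx L M) = A :=
    fun A => Prod.ext rfl (sub_sub_cancel 1 A.2)
  have hsel : ∀ A Q : HubbardFieldIdx L M, A ≠ (Q.1, 1 - Q.2) → kernel ℂ W 2 ![A, Q] = 0 := fun A Q h => by
    rw [hW]; exact covResp_kernel_two_eq_zero_of_ne_bar s β U h
  have hsel' : ∀ A Q : HubbardFieldIdx L M, A ≠ Q → kernel ℂ W 2 ![((A.1, 1 - A.2) : HubbardFieldIdx L M), Q] = 0 :=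
    fun A Q h => hsel _ Q fun h' => h (by
      have h1 := congrArg Prod.fst h'
      have h2 := congrArg Prod.snd h'
      dsimp only at h1 h2
      exact Prod.ext h1 (sub_right_injective h2))
  have hCn : ∀ A : HubbardFieldIdx L M, ‖normalCovariance L M sdot A (A.1, 1 - A.2)‖ = ‖sdot A.1‖ :=
    norm_normalCovariance_bar_right sdot
  have hCn' : ∀ A : HubbardFieldIdx L M, ‖normalCovariance L M sdot (A.1, 1 - A.2) A‖ = ‖sdot A.1‖ :=
    norm_normalCovariance_bar_left sdot
  -- (1) expand the pairing; the inner sum only sees `B = Ā`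
  have hexp : kernel ℂ (grassmannDerivPairing ℂ (normalCovariance L M sdot) W W) 4 X =
      ∑ A : HubbardFieldIdx L M, normalCovariance L M sdot A (A.1, 1 - A.2) *
        kernel ℂ (grassmannDeriv ℂ A W * grassmannDeriv ℂ ((A.1, 1 - A.2) : HubbardFieldIdx L M) W) 4 X := by
    rw [grassmannDerivPairing_apply, kernel_sum]
    refine sum_congr rfl fun A _ => ?_
    rw [kernel_sum]
    simp only [kernel_smul]
    exact Finset.sum_eq_single ((A.1, 1 - A.2) : HubbardFieldIdx L M)
      (fun B _ hB => by rw [normalCovariance_eq_zero_of_ne_bar sdot A B hB, zero_mul]) (fun h => absurd (mem_univ _) h)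
  -- (2) the collapse of the product sums under the selection rule
  have G1 : ∀ (Q : HubbardFieldIdx L M) (Z : Fin 3 → HubbardFieldIdx L M),
      ∑ A : HubbardFieldIdx L M, ‖normalCovariance L M sdot A (A.1, 1 - A.2)‖ *
          (‖kernel ℂ W 2 ![A, Q]‖ * ‖kernel ℂ W 4 (Matrix.vecCons ((A.1, 1 - A.2) : HubbardFieldIdx L M) Z)‖) =
        ‖sdot Q.1‖ * (‖kernel ℂ W 2 ![((Q.1, 1 - Q.2) : HubbardFieldIdx L M), Q]‖ * ‖kernel ℂ W 4 (Matrix.vecCons Q Z)‖) := by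
    intro Q Z
    rw [Finset.sum_eq_single ((Q.1, 1 - Q.2) : HubbardFieldIdx L M)
      (fun A _ hA => by rw [hsel A Q hA, norm_zero, zero_mul, mul_zero]) (fun h => absurd (mem_univ _) h), hbb Q, hCn' Q]
  have G2 : ∀ (Q : HubbardFieldIdx L M) (Z : Fin 3 → HubbardFieldIdx L M),
      ∑ A : HubbardFieldIdx L M, ‖normalCovariance L M sdot A (A.1, 1 - A.2)‖ *
          (‖kernel ℂ W 4 (Matrix.vecCons A Z)‖ * ‖kernel ℂ W 2 ![((A.1, 1 - A.2) : HubbardFieldIdx L M), Q]‖) =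
        ‖sdot Q.1‖ * (‖kernel ℂ W 4 (Matrix.vecCons Q Z)‖ * ‖kernel ℂ W 2 ![((Q.1, 1 - Q.2) : HubbardFieldIdx L M), Q]‖) := by
    intro Q Z
    rw [Finset.sum_eq_single Q (fun A _ hA => by rw [hsel' A Q hA, norm_zero, mul_zero, mul_zero])
      (fun h => absurd (mem_univ _) h), hCn Q]
  obtain ⟨m0, m1, m2, m3⟩ := norm_kernel_four_minors_eq W X
  -- (3) assemble
  rw [hexp]
  refine (norm_sum_le _ _).trans ?_
  refine (sum_le_sum fun A _ => (norm_mul_le _ _).trans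
    (mul_le_mul_of_nonneg_left (norm_kernel_four_deriv_mul_deriv_le hWe hWe A ((A.1, 1 - A.2) : HubbardFieldIdx L M) X)
      (norm_nonneg _))).trans ?_
  refine le_of_eq ?_
  simp only [mul_left_comm _ (2 : ℝ)]
  rw [← Finset.mul_sum]
  simp only [mul_add, Finset.sum_add_distrib]
  rw [G1 (X 0) ![X 1, X 2, X 3], G1 (X 1) ![X 0, X 2, X 3], G1 (X 2) ![X 0, X 1, X 3], G1 (X 3) ![X 0, X 1, X 2],
    G2 (X 3) ![X 0, X 1, X 2], G2 (X 2) ![X 0, X 1, X 3], G2 (X 1) ![X 0, X 2, X 3], G2 (X 0) ![X 1, X 2, X 3]]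
  rw [m0, m1, m2, m3, Fin.sum_univ_four]
  ring

/-! ## §4 The response inequality for the four-leg kernel at one string -/

/-- **THE COVARIANCE RESPONSE OF THE FOUR-LEG KERNEL AT ONE STRING** (Polchinski interpolation, mean-value form).
`𝒲_t := effAction (C₀ + t(C₁ − C₀)) V_U`, `C_i = normalCovariance s_i`; if on `t ∈ [0,1]` the partition function does not vanish,
the six-leg kernels at `(X, Ā, A)` are `≤ N₆`, the two-leg kernels at `(X̄_i, X_i)` are `≤ S`, the four-leg kernel at `X` is `≤ N₄`,
and the symbol shift at the external labels is `≤ D` (`‖(s₁ − s₀)(X_i.1)‖ ≤ D`), then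
`‖𝒲[s₁]₄(X) − 𝒲[s₀]₄(X)‖ ≤ 30·(Σ_p ‖(s₁−s₀) p‖)·N₆ + 8·D·S·N₄`. -/
theorem covResp_norm_kernel_four_sub_le (s₀ s₁ : FreqMomentum L M × Fin 2 → ℂ) (β U : ℝ) (X : Fin 4 → HubbardFieldIdx L M)
    (hZ : ∀ t ∈ Set.Icc (0 : ℝ) 1, effPartitionFn ℂ (normalCovariance L M s₀ + ((t : ℂ)) • (normalCovariance L M s₁ - normalCovariance L M s₀))
      (hubbardInteraction L M β U) ≠ 0)
    {N₆ S N₄ D : ℝ}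
    (hN6 : ∀ t ∈ Set.Icc (0 : ℝ) 1, ∀ A : HubbardFieldIdx L M,
      ‖kernel ℂ (effAction ℂ (normalCovariance L M s₀ + ((t : ℂ)) • (normalCovariance L M s₁ - normalCovariance L M s₀))
        (hubbardInteraction L M β U)) 6 (Fin.snoc (Fin.snoc X (A.1, 1 - A.2) : Fin 5 → HubbardFieldIdx L M) A)‖ ≤ N₆)
    (hS : ∀ t ∈ Set.Icc (0 : ℝ) 1, ∀ i : Fin 4,
      ‖kernel ℂ (effAction ℂ (normalCovariance L M s₀ + ((t : ℂ)) • (normalCovariance L M s₁ - normalCovariance L M s₀))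
        (hubbardInteraction L M β U)) 2 ![(((X i).1, 1 - (X i).2) : HubbardFieldIdx L M), X i]‖ ≤ S)
    (hN4 : ∀ t ∈ Set.Icc (0 : ℝ) 1,
      ‖kernel ℂ (effAction ℂ (normalCovariance L M s₀ + ((t : ℂ)) • (normalCovariance L M s₁ - normalCovariance L M s₀))
        (hubbardInteraction L M β U)) 4 X‖ ≤ N₄)
    (hD : ∀ i : Fin 4, ‖s₁ (X i).1 - s₀ (X i).1‖ ≤ D) :
    ‖kernel ℂ (effAction ℂ (normalCovariance L M s₁) (hubbardInteraction L M β U)) 4 X -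
        kernel ℂ (effAction ℂ (normalCovariance L M s₀) (hubbardInteraction L M β U)) 4 X‖ ≤
      30 * (∑ p, ‖s₁ p - s₀ p‖) * N₆ + 8 * D * S * N₄ := by
  classical
  letI : LinearOrder (HubbardFieldIdx L M) := LinearOrder.lift' (Fintype.equivFin _) (Fintype.equivFin _).injective
  -- the four-leg kernel at `X` as a linear functional
  let Φ : HubbardGrassmann L M →ₗ[ℂ] ℂ :=
    { toFun := fun F => kernel ℂ F 4 X
      map_add' := fun F G => kernel_add ℂ F G 4 X
      map_smul' := fun c F => by rw [kernel_smul, RingHom.id_apply, smul_eq_mul] }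
  have hΦ1 : Φ 1 = 0 := by
    show kernel ℂ (1 : HubbardGrassmann L M) 4 X = 0
    rw [kernel_def, iterDeriv_succ_apply, grassmannDeriv_one, map_zero, map_zero, mul_zero]
  have hV0 := constPart_hubbardInteraction L M β U
  have hVe : hubbardInteraction L M β U ∈ evenOdd ℂ (ι := HubbardFieldIdx L M) 0 := hubbardInteraction_mem_evenOdd_zero β U
  refine norm_apply_effAction_sub_le_of_linePath (normalCovariance L M s₀) (normalCovariance L M s₁) hV0 hVe hZ Φ hΦ1 ?_
  intro t ht
  have hNt := hN6 t ht
  have hSt := hS t ht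
  have hN4t := hN4 t ht
  rw [normalCovariance_linePath, normalCovariance_sub]
  rw [normalCovariance_linePath] at hNt hSt hN4t
  set st : FreqMomentum L M × Fin 2 → ℂ := fun p => s₀ p + (t : ℂ) * (s₁ p - s₀ p) with hst
  set W := effAction ℂ (normalCovariance L M st) (hubbardInteraction L M β U) with hW
  have hloop : ‖Φ (grassmannLaplacian ℂ (normalCovariance L M fun p => s₁ p - s₀ p) W)‖ ≤ 30 * (∑ p, ‖s₁ p - s₀ p‖) * N₆ :=
    covResp_norm_kernel_four_laplacian_le (fun p => s₁ p - s₀ p) W X hNt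
  have htree : ‖Φ (grassmannDerivPairing ℂ (normalCovariance L M fun p => s₁ p - s₀ p) W W)‖ ≤
      4 * (∑ i : Fin 4, ‖s₁ (X i).1 - s₀ (X i).1‖ *
          ‖kernel ℂ W 2 ![(((X i).1, 1 - (X i).2) : HubbardFieldIdx L M), X i]‖) * ‖kernel ℂ W 4 X‖ :=
    covResp_norm_kernel_four_pairing_le (fun p => s₁ p - s₀ p) st β U X
  have hS0 : 0 ≤ S := (norm_nonneg _).trans (hSt 0)
  have hsum : ∑ i : Fin 4, ‖s₁ (X i).1 - s₀ (X i).1‖ *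
      ‖kernel ℂ W 2 ![(((X i).1, 1 - (X i).2) : HubbardFieldIdx L M), X i]‖ ≤ 4 * (D * S) := by
    calc _ ≤ ∑ _i : Fin 4, D * S :=
          sum_le_sum fun i _ => mul_le_mul (hD i) (hSt i) (norm_nonneg _) ((norm_nonneg _).trans (hD i))
      _ = 4 * (D * S) := by simp
  have hD0 : 0 ≤ D := (norm_nonneg _).trans (hD 0)
  have htree' : ‖Φ (grassmannDerivPairing ℂ (normalCovariance L M fun p => s₁ p - s₀ p) W W)‖ ≤ 4 * (4 * (D * S)) * N₄ :=
    htree.trans (mul_le_mul (mul_le_mul_of_nonneg_left hsum (by norm_num)) hN4t (norm_nonneg _)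
      (mul_nonneg (by norm_num) (mul_nonneg (by norm_num) (mul_nonneg hD0 hS0))))
  calc ‖Φ (grassmannLaplacian ℂ (normalCovariance L M fun p => s₁ p - s₀ p) W) -
        (2 : ℂ)⁻¹ * Φ (grassmannDerivPairing ℂ (normalCovariance L M fun p => s₁ p - s₀ p) W W)‖
      ≤ ‖Φ (grassmannLaplacian ℂ (normalCovariance L M fun p => s₁ p - s₀ p) W)‖ +
          ‖(2 : ℂ)⁻¹ * Φ (grassmannDerivPairing ℂ (normalCovariance L M fun p => s₁ p - s₀ p) W W)‖ := norm_sub_le _ _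
    _ ≤ 30 * (∑ p, ‖s₁ p - s₀ p‖) * N₆ + 8 * D * S * N₄ := by
      refine add_le_add hloop ?_
      rw [norm_mul, norm_inv, RCLike.norm_ofNat]
      calc (2 : ℝ)⁻¹ * ‖Φ (grassmannDerivPairing ℂ (normalCovariance L M fun p => s₁ p - s₀ p) W W)‖
          ≤ 2⁻¹ * (4 * (4 * (D * S)) * N₄) := mul_le_mul_of_nonneg_left htree' (by norm_num)
        _ = 8 * D * S * N₄ := by ring

end Summit.HubbardSuperconductivity.HubbardSuperconductivity.Theorems.EngineV8

end
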